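import Mathlib
import HarnessLib
import Summits.Ventures.LatticeQCDFlow.Scaling.ConvolutionPowerCompensation
import Summits.Ventures.LatticeQCDFlow.Scaling.CorrelatorFloorTwoDimU1

/-!
# LatticeQCDFlow / Scaling — `U(1)`: the Wilson weight is positive definite, so EVERY convolution
# power of it peaks at the identity, and the one-plaquette density `w·(K_wᵐ w)` of the 2-d torus is
# STRICTLY maximal at the identity (the strictness statement for the gauge lower bound of C5)

HONEST FRAMING: exact (Metropolis-corrected) sampling algorithms for lattice gauge theory;
figures of merit are autocorrelation/cost numbers at stated couplings and volumes; no
continuum-physics claim.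

Venture `LatticeQCDFlow` (cell pub-lqcd), topic `Scaling`, FANOUT row 30 (lean-1, GEN-17) — OUR WORK.
`Scaling/HaarConvolutionRatio.iterate_odd_apply_le` proves, for every compact group and symmetric
weight, that the ODD convolution powers `K_w^{2i+1} w` peak at the identity (Cauchy–Schwarz) and
leaves the even powers ("needs positive-definiteness of `w`; not claimed"; downstream,
`Scaling/FluxTunnellingU1Explicit` therefore takes `L` even).  For `U(1)` and the Wilson weight
`w_β(g) = e^{−β(1 − Re g)}` (`u1W`) we supply positive-definiteness with NO harmonic analysis:
`e^{β Re(ā c)} = e^{β Re a Re c} · e^{β Im a Im c}`, each factor a power series with non-negative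
coefficients in products of one-variable functions.

* §1 **`hasSum_vonMises_form`** — for bounded measurable real `f, h` and any real `β`:
  `∫∫ f(a) h(c) e^{β Re(a⁻¹c)} d(Haar⊗Haar) = Σ_{n,m} (βⁿ/n!)(βᵐ/m!)·M_{nm}(f) M_{nm}(h)`,
  `M_{nm}(f) = ∫ f·Reⁿ·Imᵐ dHaar`; hence (`β ≥ 0`) **`vonMises_form_le_half_add`**:
  `B(f,h) ≤ (B(f,f) + B(h,h))/2`, and `vonMises_form_translate`: `B(f(u⁻¹·), h(u⁻¹·)) = B(f,h)`.
* §2 **`u1_iterate_even_apply_le`** — EVEN POWERS PEAK AT THE IDENTITY (`(K_w^{2k+2} w)(u) =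
  e^{−β}·B(f(u⁻¹·), f)`, `f = K_wᵏ w`, by self-adjointness and translation covariance of `K_w`); with
  the tree's odd case **`u1_iterate_apply_le_apply_one`**: `(K_wᵐ w)(u) ≤ (K_wᵐ w)(1)`, all `m`, `u`.
* §3 **`u1_plaquetteDensity_lt`** — STRICTNESS: for `β > 0`, every `m`, every `u ≠ 1`,
  `w(u)·(K_wᵐ w)(u) < w(1)·(K_wᵐ w)(1)`.  With `m = L² − 2`, `w·(K_wᵐ w)` is (up to normalisation) the
  density of ONE plaquette holonomy of the two-dimensional `U(1)` Wilson measure on `(ℤ/L)²`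
  (`Scaling/PlaquetteMarginals2D.lintegral_weight_mul_eq_iterate`, `P` = one plaquette), i.e. the
  strictness statement asked for in lean-1 GEN-16's successor note, item (2) (gauge lower bound).

READING (value-free): the one-plaquette law of 2-d `U(1)` is strictly peaked at the identity for every
`β > 0` and every `L ≥ 2`; the parity restriction `L` even of the explicit tunnelling files is an
artefact of the method.  NOT CLAIMED: the identification of GEN-15's class function (the exact
conditional of the plaquette-closing link, `Scaling/AutoregressiveGaugePlaquetteClass`) with this
density — expected, not typed here; non-abelian groups; `β < 0`.  Elementary given the parents; no
`def`; nothing is cited as a fact; no `sorry`.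
-/

noncomputable section

namespace Summit.Ventures.LatticeQCDFlow.Theory2.HaarConv

open MeasureTheory Real Finset
open Literature.MathematicalPhysics.QuantumFieldTheory Literature.MathematicalPhysics.QuantumLattice
open Summit.Ventures.LatticeQCDFlow.Theory2.Lattice.TwoDim (measurable_circle_re abs_circle_re_le_one)
open scoped ENNReal

/-! ## §0 Small facts about `U(1)` (`Re` is measurable and `≤ 1`: tree `CorrelatorFloorTwoDimU1`) -/

/-- Measurability of `Im` on the circle. [folklore] -/
theorem measurable_circle_im' : Measurable fun z : Circle => ((z : Circle) : ℂ).im := by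
  have hcoe : Continuous fun z : Circle => (z : ℂ) := continuous_subtype_val
  exact (Complex.continuous_im.comp hcoe).measurable

/-- On the circle `Re z = 1` only at `z = 1`. [folklore] -/
theorem circle_re_lt_one {z : Circle} (hz : z ≠ 1) : ((z : Circle) : ℂ).re < 1 := by
  have hle : ((z : Circle) : ℂ).re ≤ 1 := (le_abs_self _).trans (abs_circle_re_le_one z)
  refine lt_of_le_of_ne hle fun h => hz ?_
  have hsq : Complex.normSq (z : ℂ) = 1 := Circle.normSq_coe z
  rw [Complex.normSq_apply, h] at hsq
  have him : ((z : Circle) : ℂ).im = 0 := by nlinarith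
  exact Circle.ext (Complex.ext (by simp [h]) (by simp [him]))

/-! ## §1 The von Mises form `B(f,h) = ∫∫ f(a) h(c) e^{β Re(a⁻¹ c)}` is positive semi-definite -/

section Form

open scoped Nat

variable {β : ℝ}

/-- The norm of a term of the exponential series. [folklore] -/
theorem norm_pow_div_factorial (x : ℝ) (n : ℕ) :
    ‖x ^ n / (n ! : ℝ)‖ = |x| ^ n / (n ! : ℝ) := by
  rw [norm_div, norm_pow, Real.norm_eq_abs, Real.norm_eq_abs, Nat.abs_cast]

/-- Pointwise: `f(a) h(c) e^{β Re(a⁻¹c)}` is the sum over `(n, m)` of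
`(βⁿ/n!)(βᵐ/m!) · (f(a) Reⁿa Imᵐa) · (h(c) Reⁿc Imᵐc)`. [ours] -/
theorem hasSum_vonMises_pointwise (f h : Circle → ℝ) (a c : Circle) :
    HasSum (fun nm : ℕ × ℕ => (β ^ nm.1 / nm.1 ! * (β ^ nm.2 / nm.2 !)) *
        ((f a * ((a : ℂ).re ^ nm.1 * (a : ℂ).im ^ nm.2)) *
          (h c * ((c : ℂ).re ^ nm.1 * (c : ℂ).im ^ nm.2))))
      (f a * h c * Real.exp (β * ((a⁻¹ * c : Circle) : ℂ).re)) := by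
  set x : ℝ := β * ((a : ℂ).re * (c : ℂ).re) with hx
  set y : ℝ := β * ((a : ℂ).im * (c : ℂ).im) with hy
  have e1 : HasSum (fun n : ℕ => x ^ n / n !) (Real.exp x) := by
    rw [congrFun Real.exp_eq_exp_ℝ x]; exact NormedSpace.expSeries_div_hasSum_exp x
  have e2 : HasSum (fun m : ℕ => y ^ m / m !) (Real.exp y) := by
    rw [congrFun Real.exp_eq_exp_ℝ y]; exact NormedSpace.expSeries_div_hasSum_exp y
  have hs : Summable fun nm : ℕ × ℕ => x ^ nm.1 / nm.1 ! * (y ^ nm.2 / nm.2 !) := by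
    refine summable_mul_of_summable_norm (f := fun n : ℕ => x ^ n / n !)
      (g := fun m : ℕ => y ^ m / m !) ?_ ?_
    · simpa only [norm_pow_div_factorial] using Real.summable_pow_div_factorial |x|
    · simpa only [norm_pow_div_factorial] using Real.summable_pow_div_factorial |y|
  have e12 := (e1.mul e2 hs).mul_left (f a * h c)
  have hexp : Real.exp x * Real.exp y = Real.exp (β * ((a⁻¹ * c : Circle) : ℂ).re) := by
    rw [← Real.exp_add, Circle.coe_mul, Circle.coe_inv_eq_conj, Complex.mul_re, Complex.conj_re,
      Complex.conj_im, hx, hy]; ring_nf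
  have hfun : (fun nm : ℕ × ℕ => (β ^ nm.1 / nm.1 ! * (β ^ nm.2 / nm.2 !)) *
      ((f a * ((a : ℂ).re ^ nm.1 * (a : ℂ).im ^ nm.2)) *
        (h c * ((c : ℂ).re ^ nm.1 * (c : ℂ).im ^ nm.2)))) =
      fun nm : ℕ × ℕ => f a * h c * (x ^ nm.1 / nm.1 ! * (y ^ nm.2 / nm.2 !)) := by
    funext nm
    simp only [hx, hy, mul_pow]
    ring
  rw [hfun, ← hexp]
  exact e12

variable (f h : Circle → ℝ)

/-- **THE VON MISES FORM AS A POSITIVE SERIES**: for bounded measurable `f, h` on `U(1)`,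
`∫ f(a) h(c) e^{β Re(a⁻¹c)} d(Haar⊗Haar)(a,c) = Σ_{(n,m)} (βⁿ/n!)(βᵐ/m!)·M_{nm}(f)·M_{nm}(h)` with
`M_{nm}(f) = ∫ f·Reⁿ·Imᵐ dHaar` (as a `HasSum`). [ours] -/
theorem hasSum_vonMises_form (hfm : Measurable f) (hhm : Measurable h) {Cf Ch : ℝ}
    (hfb : ∀ a, |f a| ≤ Cf) (hhb : ∀ c, |h c| ≤ Ch) :
    HasSum (fun nm : ℕ × ℕ => (β ^ nm.1 / nm.1 ! * (β ^ nm.2 / nm.2 !)) *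
        ((∫ a, f a * ((a : ℂ).re ^ nm.1 * (a : ℂ).im ^ nm.2) ∂(haarProbability Circle)) *
          ∫ c, h c * ((c : ℂ).re ^ nm.1 * (c : ℂ).im ^ nm.2) ∂(haarProbability Circle)))
      (∫ p : Circle × Circle, f p.1 * h p.2 * Real.exp (β * ((p.1⁻¹ * p.2 : Circle) : ℂ).re)
        ∂((haarProbability Circle).prod (haarProbability Circle))) := by
  set μ := haarProbability Circle
  let T : ℕ × ℕ → Circle × Circle → ℝ := fun nm p => (β ^ nm.1 / nm.1 ! * (β ^ nm.2 / nm.2 !)) *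
    ((f p.1 * ((p.1 : ℂ).re ^ nm.1 * (p.1 : ℂ).im ^ nm.2)) *
      (h p.2 * ((p.2 : ℂ).re ^ nm.1 * (p.2 : ℂ).im ^ nm.2)))
  have hgm : ∀ {g : Circle → ℝ}, Measurable g → ∀ n m : ℕ,
      Measurable fun a : Circle => g a * ((a : ℂ).re ^ n * (a : ℂ).im ^ m) := fun hg n m =>
    hg.mul ((measurable_circle_re.pow_const n).mul (measurable_circle_im'.pow_const m))
  have hTm : ∀ nm, Measurable (T nm) := fun nm =>
    (((hgm hfm nm.1 nm.2).comp measurable_fst).mul ((hgm hhm nm.1 nm.2).comp measurable_snd)).const_mul _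
  have hpow1 : ∀ (z : Circle) (n m : ℕ), |(z : ℂ).re| ^ n * |(z : ℂ).im| ^ m ≤ 1 := fun z n m =>
    mul_le_one₀ (pow_le_one₀ (abs_nonneg _) (abs_circle_re_le_one z)) (pow_nonneg (abs_nonneg _) _)
      (pow_le_one₀ (abs_nonneg _) ((Complex.abs_im_le_norm _).trans (Circle.norm_coe z).le))
  have hgb : ∀ {g : Circle → ℝ} {C : ℝ}, (∀ a, |g a| ≤ C) → ∀ (a : Circle) (n m : ℕ),
      |g a| * (|(a : ℂ).re| ^ n * |(a : ℂ).im| ^ m) ≤ C := fun hg a n m =>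
    (mul_le_mul (hg a) (hpow1 a n m) (by positivity) ((abs_nonneg _).trans (hg 1))).trans
      (by rw [mul_one])
  have h0f : 0 ≤ Cf := (abs_nonneg _).trans (hfb 1)
  have hTb : ∀ nm p, ‖T nm p‖ ≤ |β| ^ nm.1 / nm.1 ! * (|β| ^ nm.2 / nm.2 !) * (Cf * Ch) := by
    intro nm p
    simp only [T, Real.norm_eq_abs, abs_mul, abs_div, abs_pow, Nat.abs_cast]
    gcongr
    · exact hgb hfb _ _ _
    · exact hgb hhb _ _ _
  have hTi : ∀ nm, Integrable (T nm) (μ.prod μ) := fun nm =>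
    Integrable.mono' (integrable_const _) (hTm nm).aestronglyMeasurable (ae_of_all _ (hTb nm))
  have hsum : Summable fun nm : ℕ × ℕ => ∫ p, ‖T nm p‖ ∂(μ.prod μ) := by
    have hmaj : Summable fun nm : ℕ × ℕ => |β| ^ nm.1 / nm.1 ! * (|β| ^ nm.2 / nm.2 !) * (Cf * Ch) := by
      refine Summable.mul_right _ ?_
      refine summable_mul_of_summable_norm (f := fun n : ℕ => |β| ^ n / n !)
        (g := fun m : ℕ => |β| ^ m / m !) ?_ ?_
      · simpa only [norm_pow_div_factorial, abs_abs] using Real.summable_pow_div_factorial |β|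
      · simpa only [norm_pow_div_factorial, abs_abs] using Real.summable_pow_div_factorial |β|
    refine Summable.of_nonneg_of_le (fun nm => integral_nonneg fun p => norm_nonneg _) (fun nm => ?_) hmaj
    calc ∫ p, ‖T nm p‖ ∂(μ.prod μ) ≤ ∫ _, |β| ^ nm.1 / nm.1 ! * (|β| ^ nm.2 / nm.2 !) * (Cf * Ch)
          ∂(μ.prod μ) := integral_mono (hTi nm).norm (integrable_const _) (hTb nm)
      _ = _ := by rw [integral_const, Measure.real, measure_univ, ENNReal.toReal_one, one_smul]
  have hmain := hasSum_integral_of_summable_integral_norm hTi hsum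
  have hlim : (fun p : Circle × Circle => ∑' nm, T nm p) =
      fun p => f p.1 * h p.2 * Real.exp (β * ((p.1⁻¹ * p.2 : Circle) : ℂ).re) :=
    funext fun p => (hasSum_vonMises_pointwise f h p.1 p.2).tsum_eq
  have hterm : (fun nm : ℕ × ℕ => ∫ p, T nm p ∂(μ.prod μ)) = fun nm : ℕ × ℕ =>
      (β ^ nm.1 / nm.1 ! * (β ^ nm.2 / nm.2 !)) *
        ((∫ a, f a * ((a : ℂ).re ^ nm.1 * (a : ℂ).im ^ nm.2) ∂μ) *
          ∫ c, h c * ((c : ℂ).re ^ nm.1 * (c : ℂ).im ^ nm.2) ∂μ) := by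
    funext nm
    simp only [T]
    rw [integral_const_mul]
    congr 1
    exact integral_prod_mul (μ := μ) (ν := μ)
      (fun a : Circle => f a * ((a : ℂ).re ^ nm.1 * (a : ℂ).im ^ nm.2))
      (fun c : Circle => h c * ((c : ℂ).re ^ nm.1 * (c : ℂ).im ^ nm.2))
  rwa [hlim, hterm] at hmain

/-- **POSITIVE SEMI-DEFINITENESS, usable form**: for `β ≥ 0` and bounded measurable `f, h`,
`B(f,h) ≤ (B(f,f) + B(h,h))/2` where `B(f,h) = ∫∫ f(a) h(c) e^{β Re(a⁻¹c)}` (termwise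
`xy ≤ (x² + y²)/2` in `hasSum_vonMises_form`, all coefficients `≥ 0`). [ours] -/
theorem vonMises_form_le_half_add (hβ : 0 ≤ β) (hfm : Measurable f) (hhm : Measurable h)
    {Cf Ch : ℝ} (hfb : ∀ a, |f a| ≤ Cf) (hhb : ∀ c, |h c| ≤ Ch) :
    ∫ p : Circle × Circle, f p.1 * h p.2 * Real.exp (β * ((p.1⁻¹ * p.2 : Circle) : ℂ).re)
        ∂((haarProbability Circle).prod (haarProbability Circle)) ≤
      ((∫ p : Circle × Circle, f p.1 * f p.2 * Real.exp (β * ((p.1⁻¹ * p.2 : Circle) : ℂ).re)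
          ∂((haarProbability Circle).prod (haarProbability Circle))) +
        ∫ p : Circle × Circle, h p.1 * h p.2 * Real.exp (β * ((p.1⁻¹ * p.2 : Circle) : ℂ).re)
          ∂((haarProbability Circle).prod (haarProbability Circle))) / 2 := by
  have Hfh := hasSum_vonMises_form f h hfm hhm hfb hhb (β := β)
  have Hff := hasSum_vonMises_form f f hfm hfm hfb hfb (β := β)
  have Hhh := hasSum_vonMises_form h h hhm hhm hhb hhb (β := β)
  have H := ((Hff.add Hhh).div_const 2).sub Hfh
  rw [← sub_nonneg]
  refine H.nonneg fun nm => ?_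
  have hc : 0 ≤ β ^ nm.1 / nm.1 ! * (β ^ nm.2 / nm.2 !) := by positivity
  set x := ∫ a, f a * ((a : ℂ).re ^ nm.1 * (a : ℂ).im ^ nm.2) ∂(haarProbability Circle)
  set y := ∫ a, h a * ((a : ℂ).re ^ nm.1 * (a : ℂ).im ^ nm.2) ∂(haarProbability Circle)
  have : 0 ≤ β ^ nm.1 / nm.1 ! * (β ^ nm.2 / nm.2 !) * (x - y) ^ 2 := mul_nonneg hc (sq_nonneg _)
  nlinarith [this]

/-- **Translation invariance of the form**: `B(f(u⁻¹·), h(u⁻¹·)) = B(f, h)` (left invariance of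
Haar on each factor; `Re((ua)⁻¹(uc)) = Re(a⁻¹c)`). [ours] -/
theorem vonMises_form_translate (hfm : Measurable f) (hhm : Measurable h) (u : Circle) :
    ∫ p : Circle × Circle, f (u⁻¹ * p.1) * h (u⁻¹ * p.2) *
        Real.exp (β * ((p.1⁻¹ * p.2 : Circle) : ℂ).re)
        ∂((haarProbability Circle).prod (haarProbability Circle)) =
      ∫ p : Circle × Circle, f p.1 * h p.2 * Real.exp (β * ((p.1⁻¹ * p.2 : Circle) : ℂ).re)
        ∂((haarProbability Circle).prod (haarProbability Circle)) := by
  set μ := haarProbability Circle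
  have hT : MeasurePreserving (Prod.map (fun a : Circle => u * a) (fun c : Circle => u * c))
      (μ.prod μ) (μ.prod μ) :=
    (measurePreserving_mul_left μ u).prod (measurePreserving_mul_left μ u)
  have hgm : Measurable fun p : Circle × Circle =>
      f (u⁻¹ * p.1) * h (u⁻¹ * p.2) * Real.exp (β * ((p.1⁻¹ * p.2 : Circle) : ℂ).re) :=
    ((hfm.comp ((measurable_const_mul u⁻¹).comp measurable_fst)).mul
      (hhm.comp ((measurable_const_mul u⁻¹).comp measurable_snd))).mul
      (Real.measurable_exp.comp ((measurable_circle_re.comp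
        (measurable_fst.inv.mul measurable_snd)).const_mul β))
  conv_lhs => rw [← hT.map_eq]
  rw [integral_map hT.measurable.aemeasurable hgm.aestronglyMeasurable]
  refine integral_congr_ae (ae_of_all _ fun p => ?_)
  have h3 : (u * p.1)⁻¹ * (u * p.2) = p.1⁻¹ * p.2 := by
    rw [mul_inv_rev, mul_assoc, inv_mul_cancel_left, mul_comm]
  simp only [Prod.map_fst, Prod.map_snd, inv_mul_cancel_left, h3]

end Form

/-! ## §2 Every convolution power of the `U(1)` Wilson weight peaks at the identity -/

section Powers

variable {β : ℝ}

/-- Rewriting an even power: `(K_w^{2k+2} w)(u) = ∫ (∫ (K_wᵏ w)(c) w(v⁻¹c) dc) · (K_wᵏ w)(u⁻¹v) dv`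
(self-adjointness and translation covariance of `K_w`, `Scaling/HaarConvolutionRatio`; any compact
group and symmetric weight). [ours] -/
theorem iterate_even_succ_eq_lintegral {G : Type*} [Group G] [TopologicalSpace G]
    [IsTopologicalGroup G] [CompactSpace G] [SecondCountableTopology G] [MeasurableSpace G]
    [BorelSpace G] {w : G → ℝ≥0∞} (hw : Measurable w) (hws : ∀ g, w g⁻¹ = w g) (k : ℕ) (u : G) :
    (haarConv w)^[2 * (k + 1)] w u =
      ∫⁻ v, (∫⁻ c, (haarConv w)^[k] w c * w (v⁻¹ * c) ∂(haarProbability G)) *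
        (haarConv w)^[k] w (u⁻¹ * v) ∂(haarProbability G) := by
  rw [show 2 * (k + 1) = (2 * k + 1) + 1 by ring, Function.iterate_succ_apply',
    haarConv_eq_lintegral_mul_inv, show 2 * k + 1 = k + (k + 1) by ring,
    Function.iterate_add_apply,
    lintegral_iterate_mul hw hws (φ := (haarConv w)^[k + 1] w) (ψ := fun v => w (u⁻¹ * v))
      (measurable_iterate hw hw (k + 1)) (hw.comp (measurable_const_mul u⁻¹)) k,
    iterate_comp_mul_left]
  refine lintegral_congr fun v => ?_
  rw [Function.iterate_succ_apply', haarConv_eq_lintegral_mul_inv]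

/-- The even power as a value of the von Mises form: for `β ≥ 0`, with `f = K_wᵏ w` (real-valued, in
`[0,1]`), `(K_w^{2k+2} w)(u) = e^{−β} · ∫∫ f(u⁻¹v) f(c) e^{β Re(v⁻¹c)}`. [ours] -/
theorem u1_iterate_even_eq_form (hβ : 0 ≤ β) (k : ℕ) (u : Circle) :
    (haarConv (u1W β))^[2 * (k + 1)] (u1W β) u =
      ENNReal.ofReal (Real.exp (-β) *
        ∫ p : Circle × Circle,
          ((haarConv (u1W β))^[k] (u1W β) (u⁻¹ * p.1)).toReal *
            ((haarConv (u1W β))^[k] (u1W β) p.2).toReal *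
            Real.exp (β * ((p.1⁻¹ * p.2 : Circle) : ℂ).re)
          ∂((haarProbability Circle).prod (haarProbability Circle))) := by
  have hw : Measurable (u1W β) := measurable_u1W β
  have hK : Measurable ((haarConv (u1W β))^[k] (u1W β)) := measurable_iterate hw hw k
  have hK1 : ∀ v, (haarConv (u1W β))^[k] (u1W β) v ≤ 1 :=
    iterate_apply_le_one hw (u1W_le_one hβ) k
  have hKT : ∀ v, (haarConv (u1W β))^[k] (u1W β) v ≠ ⊤ := fun v =>
    ne_top_of_le_ne_top ENNReal.one_ne_top (hK1 v)
  set Fr : Circle → ℝ := fun v => ((haarConv (u1W β))^[k] (u1W β) v).toReal with hFr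
  have hFrm : Measurable Fr := hK.ennreal_toReal
  have hFr0 : ∀ v, 0 ≤ Fr v := fun v => ENNReal.toReal_nonneg
  have hFr1 : ∀ v, Fr v ≤ 1 := fun v =>
    ENNReal.toReal_le_of_le_ofReal zero_le_one (by simpa using hK1 v)
  have hofFr : ∀ v, (haarConv (u1W β))^[k] (u1W β) v = ENNReal.ofReal (Fr v) := fun v =>
    (ENNReal.ofReal_toReal (hKT v)).symm
  let Gf : Circle × Circle → ℝ := fun p => Fr (u⁻¹ * p.1) * Fr p.2 *
    (Real.exp (-β) * Real.exp (β * ((p.1⁻¹ * p.2 : Circle) : ℂ).re))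
  have hre : Measurable fun p : Circle × Circle => ((p.1⁻¹ * p.2 : Circle) : ℂ).re :=
    measurable_circle_re.comp (measurable_fst.inv.mul measurable_snd)
  have hGm : Measurable Gf :=
    (((hFrm.comp ((measurable_const_mul u⁻¹).comp measurable_fst)).mul
      (hFrm.comp measurable_snd))).mul
      (measurable_const.mul (Real.measurable_exp.comp (hre.const_mul β)))
  have hGnn : ∀ p, 0 ≤ Gf p := fun p =>
    mul_nonneg (mul_nonneg (hFr0 _) (hFr0 _)) (mul_nonneg (Real.exp_pos _).le (Real.exp_pos _).le)
  have hGb : ∀ p, ‖Gf p‖ ≤ 1 * 1 * (Real.exp (-β) * Real.exp β) := by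
    intro p
    rw [Real.norm_eq_abs, abs_of_nonneg (hGnn p)]
    have h3 : Real.exp (β * ((p.1⁻¹ * p.2 : Circle) : ℂ).re) ≤ Real.exp β := by
      have := (le_abs_self _).trans (abs_circle_re_le_one (p.1⁻¹ * p.2))
      exact Real.exp_le_exp.2 (by nlinarith)
    exact mul_le_mul (mul_le_mul (hFr1 _) (hFr1 _) (hFr0 _) zero_le_one)
      (mul_le_mul_of_nonneg_left h3 (Real.exp_pos _).le)
      (mul_nonneg (Real.exp_pos _).le (Real.exp_pos _).le) (by norm_num)
  have hGi : Integrable Gf ((haarProbability Circle).prod (haarProbability Circle)) :=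
    Integrable.mono' (integrable_const _) hGm.aestronglyMeasurable (ae_of_all _ hGb)
  rw [iterate_even_succ_eq_lintegral hw (u1W_symm β) k u]
  have hpt : ∀ v c, (haarConv (u1W β))^[k] (u1W β) c * u1W β (v⁻¹ * c) *
      (haarConv (u1W β))^[k] (u1W β) (u⁻¹ * v) = ENNReal.ofReal (Gf (v, c)) := by
    intro v c
    have hwv : u1W β (v⁻¹ * c) =
        ENNReal.ofReal (Real.exp (-β) * Real.exp (β * ((v⁻¹ * c : Circle) : ℂ).re)) := by
      rw [u1W_apply, ← Real.exp_add]; congr 1; ring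
    rw [hofFr, hofFr, hwv, ← ENNReal.ofReal_mul (hFr0 c),
      ← ENNReal.ofReal_mul (mul_nonneg (hFr0 c) (mul_nonneg (Real.exp_pos _).le (Real.exp_pos _).le))]
    congr 1
    simp only [Gf]
    ring
  have hinner : ∀ v, (∫⁻ c, (haarConv (u1W β))^[k] (u1W β) c * u1W β (v⁻¹ * c)
      ∂(haarProbability Circle)) * (haarConv (u1W β))^[k] (u1W β) (u⁻¹ * v) =
      ∫⁻ c, ENNReal.ofReal (Gf (v, c)) ∂(haarProbability Circle) := by
    intro v
    rw [← lintegral_mul_const _ (f := fun c => (haarConv (u1W β))^[k] (u1W β) c * u1W β (v⁻¹ * c))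
      (hK.mul (hw.comp (measurable_const_mul v⁻¹)))]
    exact lintegral_congr fun c => hpt v c
  rw [lintegral_congr hinner,
    lintegral_lintegral (f := fun v c => ENNReal.ofReal (Gf (v, c))) hGm.ennreal_ofReal.aemeasurable,
    ← ofReal_integral_eq_lintegral_ofReal hGi (ae_of_all _ hGnn), ← integral_const_mul]
  congr 1
  refine integral_congr_ae (ae_of_all _ fun p => ?_)
  simp only [Gf]
  ring

/-- **EVEN CONVOLUTION POWERS OF THE `U(1)` WILSON WEIGHT PEAK AT THE IDENTITY**:
`(K_w^{2i} w)(u) ≤ (K_w^{2i} w)(1)` for `β ≥ 0`, every `i`, `u` (positive-definiteness; the odd case is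
`Scaling/HaarConvolutionRatio.iterate_odd_apply_le`). [ours] -/
theorem u1_iterate_even_apply_le (hβ : 0 ≤ β) (i : ℕ) (u : Circle) :
    (haarConv (u1W β))^[2 * i] (u1W β) u ≤ (haarConv (u1W β))^[2 * i] (u1W β) 1 := by
  cases i with
  | zero =>
    have h1 : u1W β 1 = 1 := by simp [u1W_apply]
    simpa [h1] using u1W_le_one hβ u
  | succ k =>
    rw [u1_iterate_even_eq_form hβ k u, u1_iterate_even_eq_form hβ k 1]
    refine ENNReal.ofReal_le_ofReal (mul_le_mul_of_nonneg_left ?_ (Real.exp_pos _).le)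
    set f : Circle → ℝ := fun v => ((haarConv (u1W β))^[k] (u1W β) v).toReal with hfdef
    have hfm : Measurable f :=
      (measurable_iterate (measurable_u1W β) (measurable_u1W β) k).ennreal_toReal
    have hfb : ∀ v, |f v| ≤ 1 := fun v => by
      rw [hfdef, abs_of_nonneg ENNReal.toReal_nonneg]
      exact ENNReal.toReal_le_of_le_ofReal zero_le_one
        (by simpa using iterate_apply_le_one (measurable_u1W β) (u1W_le_one hβ) k v)
    simp only [inv_one, one_mul]
    have hle := vonMises_form_le_half_add (fun v => f (u⁻¹ * v)) f hβ
      (hfm.comp (measurable_const_mul u⁻¹)) hfm (fun v => hfb _) hfb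
    rw [vonMises_form_translate f f hfm hfm u (β := β)] at hle
    linarith

/-- **EVERY CONVOLUTION POWER OF THE `U(1)` WILSON WEIGHT PEAKS AT THE IDENTITY**:
`(K_wᵐ w)(u) ≤ (K_wᵐ w)(1)` for `β ≥ 0`, all `m`, `u`. [ours] -/
theorem u1_iterate_apply_le_apply_one (hβ : 0 ≤ β) (m : ℕ) (u : Circle) :
    (haarConv (u1W β))^[m] (u1W β) u ≤ (haarConv (u1W β))^[m] (u1W β) 1 := by
  rcases Nat.even_or_odd m with ⟨i, rfl⟩ | ⟨i, rfl⟩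
  · rw [← two_mul]; exact u1_iterate_even_apply_le hβ i u
  · exact iterate_odd_apply_le (measurable_u1W β) (u1W_symm β) i u

/-! ## §3 Strictness: the one-plaquette density `w·(K_wᵐ w)` is strictly maximal at the identity -/

/-- `w_β` is STRICTLY maximal at the identity for `β > 0`: `w(u) < w(1) = 1` for `u ≠ 1`. [ours] -/
theorem u1W_lt_one {β : ℝ} (hβ : 0 < β) {u : Circle} (hu : u ≠ 1) : u1W β u < u1W β 1 := by
  rw [u1W_apply, u1W_apply]
  simp only [Circle.coe_one, Complex.one_re, sub_self, mul_zero, neg_zero, Real.exp_zero,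
    ENNReal.ofReal_one]
  rw [ENNReal.ofReal_lt_one, Real.exp_lt_one_iff]
  have := circle_re_lt_one hu
  nlinarith

/-- **STRICTNESS OF THE ONE-PLAQUETTE DENSITY**: for `β > 0`, every `m` and every `u ≠ 1`,
`w(u)·(K_wᵐ w)(u) < w(1)·(K_wᵐ w)(1)` — with `m = L² − 2`, up to normalisation, the density of one
plaquette holonomy of the two-dimensional `U(1)` Wilson measure on `(ℤ/L)²`
(`Scaling/PlaquetteMarginals2D.lintegral_weight_mul_eq_iterate`): it is NOT constant. [ours] -/
theorem u1_plaquetteDensity_lt {β : ℝ} (hβ : 0 < β) (m : ℕ) {u : Circle} (hu : u ≠ 1) :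
    u1W β u * (haarConv (u1W β))^[m] (u1W β) u <
      u1W β 1 * (haarConv (u1W β))^[m] (u1W β) 1 := by
  have hne : (haarConv (u1W β))^[m] (u1W β) 1 ≠ 0 :=
    iterate_apply_ne_zero (measurable_u1W β) (u1W_ne_zero β) m 1
  have hnt : (haarConv (u1W β))^[m] (u1W β) 1 ≠ ⊤ :=
    ne_top_of_le_ne_top ENNReal.one_ne_top
      (iterate_apply_le_one (measurable_u1W β) (u1W_le_one hβ.le) m 1)
  calc u1W β u * (haarConv (u1W β))^[m] (u1W β) u
      ≤ u1W β u * (haarConv (u1W β))^[m] (u1W β) 1 := by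
        gcongr; exact u1_iterate_apply_le_apply_one hβ.le m u
    _ < u1W β 1 * (haarConv (u1W β))^[m] (u1W β) 1 :=
        ENNReal.mul_lt_mul_left hne hnt (u1W_lt_one hβ hu)

end Powers

end Summit.Ventures.LatticeQCDFlow.Theory2.HaarConv

end
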